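/-
Origin: expansion seat `prover-pub-hodgecm-mc-sinst-1-g5-0`, handover #1228 2026-08-20T12:57Z md5 4fc17c13212a (457 l., 29 decls) NEW additive leaf, ns HodgeCM.Model.ArchSideTerm + HodgeCM.Model.SInstance; imports RUN-45 #1215 ThetaAdelicSideGuardedT + RUN-50 #P50b ArchSideOfTwist34 (both PKG); drop-alone w.r.t. other kits; the guarded S families over archSideOfT' (pin R2, ν ν′ as input families); NAME LIST: HodgeCM.Model.ArchSideTerm.lineRepT'_apply_one_left · HodgeCM.Model.SInstance.SGPT'_eq_archSideOfT' · HodgeCM.Model.SInstance.hT_ROGT' (`HOME/mc/pub-hodgecm-mc-sinst-1-g5/stage/HodgeCM/Model/ThetaAdelicSideGuardedT2.lean`, md5 4fc17c13212a, 457 lines);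
landed by the gen-20 packager (p-g20) in gate run 51 as `HodgeCM/Model/ThetaAdelicSideGuardedT2.lean` (verbatim).
-/
/-
Origin: CONSTRUCTION seat `prover-pub-hodgecm-mc-sinst-1-g5-0` (unit pub-hodgecm-mc-sinst-1-g5, gen 5 of mc-sinst-1 — S-INSTANCE CONSTRUCTOR,
BINDER-OWNERS row 5 `S`), 2026-08-20; carch-1-g5's R2 ask.  KERNEL only: defs + theorems; closure {propext, Classical.choice, Quot.sound}.
Additive leaf over #1215 `ThetaAdelicSideGuardedT` and period-1 RUN-50 #P50b `ArchSideOfTwist34`; nothing of PerL ∕ QW8 is claimed.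
-/
import Summits.HodgeConjecture.HodgeCM.Model.ThetaAdelicSideGuardedT_2
import Summits.HodgeConjecture.HodgeCM.Model.ArchSideOfTwist34

/-!
# (C-LINE34) R2, S SIDE: the guarded S family over period-1's DOUBLY TWISTED term `archSideOfT'`

carch-1-g5's R2 ask (STATUS 2026-08-20 12:04Z): row 12's lines 2/3 close AT THE S PIN once the pin carries, besides the `U(V)(𝔸)` twist `ν` on
the η-split of lines 0/1 (#P43a, pin R1 = #1215/#1216), a SECOND twist `ν′` on the conjugated split of lines 2/3 (`etaT₂ = ν′⁻¹∘fst · eta₂`,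
`etaT₃ = ν′∘fst · eta₃`; period-1 `Model/ArchSideOfTwist34`, RUN-50 #P50b: `lineRepT'`, `archSideOfT'`).  This leaf is the S-family side,
the verbatim twin of #1215 `ThetaAdelicSideGuardedT` with `T ↦ T′`:

* §1 `isLFContinuous_lineRepT'`, `isLFAction_archSideOfT''`, `isThetaArchContinuous_archSideOfT''` — rows `hLF`/13 at the doubly twisted term;
* §2 **`lineRepT'_apply_one_left`**: `lineRepT' … η ν ν′ k (1, t) = lineRepD … η k (1, t)` for ALL four lines (`ν 1 = ν′ 1 = 1`), hence
  **`archLineInputT'`**: every archimedean line input over `lineRepD … k` IS one over `lineRepT' … k` (same `Φ_∞, x₀, w`) — theta-3's data and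
  the (J-μ) read-off datum transfer to pin R2 VERBATIM (answering carch's «if a field depends on ω»: only `weight`, through `ω (1, t_∞)`, where the
  twists are invisible);
* §3 `thetaAdelicSideOfPT'' V c G hG … η hη hηc ν hν hνc ν′ hν′ hν′c AG` — the predicate-guarded total term over `archSideOfT'`, read-backs,
  rows `hLF`/13 hypothesis-free;
* §4 family level `SInstance.SGPT'` (+ `SGPT'_eq_archSideOfT'`, `hLF_PT''`, `hT_PT''`), the transported read-off inputs **`SInstance.ART'`**, and the
  assembled (J-μ-pin) families **`SInstance.SRT'`** (generic guard; `ν hν hνc ν′ hν′ hν′c` as INPUT families) and **`SInstance.SROGT'`** (OG guard),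
  with `hT_RT''`, `hLF_RT''`, `hT_ROGT''`, `hLF_ROGT''`.
The CONSTRUCTED pin `SROGT'C` (`χV := χVR`, `ν := νR`, `ν′ := ν'R` of carch #CA35/#CA55) is the next leaf (`ThetaAdelicSideR2`).
Nothing here is a claim of PerL/QW8; nothing is cited as a fact.
-/

set_option autoImplicit false

noncomputable section

open scoped Matrix SchwartzMap
open NumberField NumberField.mixedEmbedding
open Literature.NumberTheory.Automorphic Literature.NumberTheory.Weil1964
open Literature.NumberTheory.GelbartRogawski1991.UnitaryDualPair
open HodgeCM.Adelic HodgeCM.PerL34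
open Literature.Geometry.ComplexHyperbolic.BallModel (U21)

namespace HodgeCM.Model

namespace ArchSideTerm

/-! ## § 1 LF-continuity and row 13 at the doubly twisted term -/

section LF

variable {L : CMField} {ι₁ : L →+* ℂ} (V : HermSpace3 L ι₁) (S : StubTree.SeesawDatum L)
variable
  (hGR : (cmSplittingDatum (L : Type) finProdFinEquiv (frameD V) (frameD_real V) (frameD_ne V) (dW S) (dW_real S)
    (dW_ne S)).CompatibleSplitting)
  (hGR₀ : (cmSplittingDatum (L : Type) (e₁) (frameD V) (frameD_real V) (frameD_ne V) (lineVec (L : Type) (dW S 0))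
    (fun _ => dW_real S 0) (fun _ => dW_ne S 0)).CompatibleSplitting)
  (hGR₁ : (cmSplittingDatum (L : Type) (e₁) (frameD V) (frameD_real V) (frameD_ne V) (lineVec (L : Type) (dW S 1))
    (fun _ => dW_real S 1) (fun _ => dW_ne S 1)).CompatibleSplitting)
  (hGR₂ : (cmSplittingDatum (L : Type) (e₁) (frameD V) (frameD_real V) (frameD_ne V) (lineVec (L : Type) (dW' S 0))
    (fun _ => dW'_real S 0) (fun _ => dW'_ne S 0)).CompatibleSplitting)
  (hGR₃ : (cmSplittingDatum (L : Type) (e₁) (frameD V) (frameD_real V) (frameD_ne V) (lineVec (L : Type) (dW' S 1))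
    (fun _ => dW'_real S 1) (fun _ => dW'_ne S 1)).CompatibleSplitting)
  (η : CMAdelic (L : Type) (frameD V) × CMAdelic (L : Type) (dW S) →* ℂˣ) (ν ν' : CMAdelic (L : Type) (frameD V) →* ℂˣ)

/-- each doubly twisted line representation acts by LF-continuous operators (LAYER B is generic in the four η's). -/
theorem isLFContinuous_lineRepT' (k : Fin 4)
    (g : ↥(regimeSubgroup L V.Hm) × ↥(NumberField.relNormOneIdeles (↥(maximalRealSubfield L)) L)) :
    IsLFContinuous (lineRepT' V S hGR hGR₀ hGR₁ hGR₂ hGR₃ η ν ν' k g) :=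
  isLFContinuous_lineRepOf V S hGR hGR₀ hGR₁ hGR₂ hGR₃ _ _ _ _ k g

/-! ## § 2 both twists are invisible on `{1} × U(1)(𝔸)`: archimedean line inputs transfer -/

/-- **`lineRepT' … η ν ν′ k (1, t) = lineRepD … η k (1, t)`**: on the `U(V)`-trivial slice the doubly twisted split IS the default split
(`ν 1 = ν′ 1 = 1`), on all four lines. -/
theorem lineRepT'_apply_one_left (k : Fin 4) (t : ↥(NumberField.relNormOneIdeles (↥(maximalRealSubfield L)) L)) :
    lineRepT' V S hGR hGR₀ hGR₁ hGR₂ hGR₃ η ν ν' k (1, t) = lineRepD V S hGR hGR₀ hGR₁ hGR₂ hGR₃ η k (1, t) := by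
  -- on pairs with trivial `U(V)`-component the two splits agree line by line
  have key : ∀ p : CMAdelic (L : Type) (frameD V) × ↥(Literature.NumberTheory.Automorphic.relNormOneIdeles (↥(maximalRealSubfield L)) L),
      p.1 = 1 →
      lineRep V S hGR hGR₀ hGR₁ hGR₂ hGR₃ (etaT₀ V S η ν) (etaT₁ V S η ν) (etaT₂ V S η ν') (etaT₃ V S η ν') k p =
        lineRep V S hGR hGR₀ hGR₁ hGR₂ hGR₃ (eta₀ V S η) (eta₁ V S η) (eta₂ V S η) (eta₃ V S η) k p := by
    rintro ⟨v, u⟩ hv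
    change v = 1 at hv
    subst hv
    fin_cases k
    · refine LinearMap.ext fun φ => ?_
      change cmLineRepFin₀ (L : Type) finProdFinEquiv e₁ (frameD V) (frameD_real V) (frameD_ne V) (dW S) (dW_real S) (dW_ne S) hGR hGR₀ hGR₁
          (etaT₀ V S η ν) (1, u) φ =
        cmLineRepFin₀ (L : Type) finProdFinEquiv e₁ (frameD V) (frameD_real V) (frameD_ne V) (dW S) (dW_real S) (dW_ne S) hGR hGR₀ hGR₁
          (eta₀ V S η) (1, u) φ
      rw [cmLineRepFin₀_apply_eq_smul_cmPairRep, cmLineRepFin₀_apply_eq_smul_cmPairRep, etaT₀_apply, map_one, inv_one, one_mul]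
    · refine LinearMap.ext fun φ => ?_
      change cmLineRepFin₁ (L : Type) finProdFinEquiv e₁ (frameD V) (frameD_real V) (frameD_ne V) (dW S) (dW_real S) (dW_ne S) hGR hGR₀ hGR₁
          (etaT₁ V S η ν) (1, u) φ =
        cmLineRepFin₁ (L : Type) finProdFinEquiv e₁ (frameD V) (frameD_real V) (frameD_ne V) (dW S) (dW_real S) (dW_ne S) hGR hGR₀ hGR₁
          (eta₁ V S η) (1, u) φ
      rw [cmLineRepFin₁_apply_eq_smul_cmPairRep, cmLineRepFin₁_apply_eq_smul_cmPairRep, etaT₁_apply, map_one, one_mul]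
    · refine LinearMap.ext fun φ => ?_
      change cmConjLineRepFin₀ (L : Type) finProdFinEquiv e₁ (frameD V) (frameD_real V) (frameD_ne V) (dW S) (dW_real S) (dW_ne S)
          (dW' S) (dW'_real S) (dW'_ne S) S.isoGL (isoGL_hg₀ S) hGR hGR₂ hGR₃ (etaT₂ V S η ν') (1, u) φ =
        cmConjLineRepFin₀ (L : Type) finProdFinEquiv e₁ (frameD V) (frameD_real V) (frameD_ne V) (dW S) (dW_real S) (dW_ne S)
          (dW' S) (dW'_real S) (dW'_ne S) S.isoGL (isoGL_hg₀ S) hGR hGR₂ hGR₃ (eta₂ V S η) (1, u) φ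
      rw [cmConjLineRepFin₀_apply_eq_smul_cmPairRep, cmConjLineRepFin₀_apply_eq_smul_cmPairRep, etaT₂_apply, map_one, inv_one, one_mul]
    · refine LinearMap.ext fun φ => ?_
      change cmConjLineRepFin₁ (L : Type) finProdFinEquiv e₁ (frameD V) (frameD_real V) (frameD_ne V) (dW S) (dW_real S) (dW_ne S)
          (dW' S) (dW'_real S) (dW'_ne S) S.isoGL (isoGL_hg₀ S) hGR hGR₂ hGR₃ (etaT₃ V S η ν') (1, u) φ =
        cmConjLineRepFin₁ (L : Type) finProdFinEquiv e₁ (frameD V) (frameD_real V) (frameD_ne V) (dW S) (dW_real S) (dW_ne S)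
          (dW' S) (dW'_real S) (dW'_ne S) S.isoGL (isoGL_hg₀ S) hGR hGR₂ hGR₃ (eta₃ V S η) (1, u) φ
      rw [cmConjLineRepFin₁_apply_eq_smul_cmPairRep, cmConjLineRepFin₁_apply_eq_smul_cmPairRep, etaT₃_apply, map_one, one_mul]
  refine key _ ?_
  show ((cmFrameEquiv (L : Type) (frameG V) V.Hm (frameD V) (frame_congr V)).toMonoidHom.comp (regimeSubgroup L V.Hm).subtype) 1 = 1
  exact map_one _

/-- **every archimedean line input over `lineRepD … k` IS one over `lineRepT' … k`** (same `Φ_∞`, `x₀`, `w`). -/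
def archLineInputT' (k : Fin 4) (A : ArchLineInput V (lineRepD V S hGR hGR₀ hGR₁ hGR₂ hGR₃ η k)) :
    ArchLineInput V (lineRepT' V S hGR hGR₀ hGR₁ hGR₂ hGR₃ η ν ν' k) where
  Φinf := A.Φinf
  x₀ := A.x₀
  hx₀ := A.hx₀
  w := A.w
  weight N t := by
    rw [lineRepT'_apply_one_left]
    exact A.weight N t

/-- (Ported verbatim from the HodgeCMPerL package; no docstring in the source.) -/
@[simp] theorem archLineInputT'_Φinf (k : Fin 4) (A : ArchLineInput V (lineRepD V S hGR hGR₀ hGR₁ hGR₂ hGR₃ η k)) :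
    (archLineInputT' V S hGR hGR₀ hGR₁ hGR₂ hGR₃ η ν ν' k A).Φinf = A.Φinf := by
  unfold archLineInputT'
  rfl

/-- (Ported verbatim from the HodgeCMPerL package; no docstring in the source.) -/
@[simp] theorem archLineInputT'_x₀ (k : Fin 4) (A : ArchLineInput V (lineRepD V S hGR hGR₀ hGR₁ hGR₂ hGR₃ η k)) :
    (archLineInputT' V S hGR hGR₀ hGR₁ hGR₂ hGR₃ η ν ν' k A).x₀ = A.x₀ := by
  unfold archLineInputT'
  rfl

/-- (Ported verbatim from the HodgeCMPerL package; no docstring in the source.) -/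
@[simp] theorem archLineInputT'_w (k : Fin 4) (A : ArchLineInput V (lineRepD V S hGR hGR₀ hGR₁ hGR₂ hGR₃ η k)) :
    (archLineInputT' V S hGR hGR₀ hGR₁ hGR₂ hGR₃ η ν ν' k A).w = A.w := by
  unfold archLineInputT'
  rfl

end LF

section Term

variable {L : CMField} {ι₁ : L →+* ℂ} (V : HermSpace3 L ι₁) (c : SeesawCtx L)
variable
  (hGR : (cmSplittingDatum (L : Type) finProdFinEquiv (frameD V) (frameD_real V) (frameD_ne V) (dW c.D) (dW_real c.D)
    (dW_ne c.D)).CompatibleSplitting)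
  (hGR₀ : (cmSplittingDatum (L : Type) (e₁) (frameD V) (frameD_real V) (frameD_ne V) (lineVec (L : Type) (dW c.D 0))
    (fun _ => dW_real c.D 0) (fun _ => dW_ne c.D 0)).CompatibleSplitting)
  (hGR₁ : (cmSplittingDatum (L : Type) (e₁) (frameD V) (frameD_real V) (frameD_ne V) (lineVec (L : Type) (dW c.D 1))
    (fun _ => dW_real c.D 1) (fun _ => dW_ne c.D 1)).CompatibleSplitting)
  (hGR₂ : (cmSplittingDatum (L : Type) (e₁) (frameD V) (frameD_real V) (frameD_ne V) (lineVec (L : Type) (dW' c.D 0))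
    (fun _ => dW'_real c.D 0) (fun _ => dW'_ne c.D 0)).CompatibleSplitting)
  (hGR₃ : (cmSplittingDatum (L : Type) (e₁) (frameD V) (frameD_real V) (frameD_ne V) (lineVec (L : Type) (dW' c.D 1))
    (fun _ => dW'_real c.D 1) (fun _ => dW'_ne c.D 1)).CompatibleSplitting)
  (η : CMAdelic (L : Type) (frameD V) × CMAdelic (L : Type) (dW c.D) →* ℂˣ)
  (hη : ∀ γU ∈ CMRat (L : Type) (frameD V), ∀ γ ∈ CMRat (L : Type) (dW c.D), η (γU, γ) = 1)
  (hηc : Continuous fun p => ((η p : ℂˣ) : ℂ))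
  (ν : CMAdelic (L : Type) (frameD V) →* ℂˣ)
  (hν : ∀ γU ∈ CMRat (L : Type) (frameD V), ν γU = 1)
  (hνc : Continuous fun v => ((ν v : ℂˣ) : ℂ))
  (ν' : CMAdelic (L : Type) (frameD V) →* ℂˣ)
  (hν' : ∀ γU ∈ CMRat (L : Type) (frameD V), ν' γU = 1)
  (hν'c : Continuous fun v => ((ν' v : ℂˣ) : ℂ))

/-- **`hLF` at period-1's doubly twisted term** (any `h₁W`, `A`). -/
theorem isLFAction_archSideOfT' (h₁W : (∀ j, 0 < (ι₁ (dW c.D j)).re) ∨ ∀ j, (ι₁ (dW c.D j)).re < 0)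
    (A : ∀ k : Fin 4, ArchLineInput V (lineRepT' V c.D hGR hGR₀ hGR₁ hGR₂ hGR₃ η ν ν' k)) (k : Fin 4) :
    ((archSideOfT' V c hGR hGR₀ hGR₁ hGR₂ hGR₃ η hη hηc ν hν hνc ν' hν' hν'c h₁W A).P k).IsLFAction :=
  fun g => isLFContinuous_lineRepT' V c.D hGR hGR₀ hGR₁ hGR₂ hGR₃ η ν ν' k g

/-- **row 13 `hT` at period-1's doubly twisted term.** -/
theorem isThetaArchContinuous_archSideOfT' (h₁W : (∀ j, 0 < (ι₁ (dW c.D j)).re) ∨ ∀ j, (ι₁ (dW c.D j)).re < 0)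
    (A : ∀ k : Fin 4, ArchLineInput V (lineRepT' V c.D hGR hGR₀ hGR₁ hGR₂ hGR₃ η ν ν' k)) (k : Fin 4) (N : ℕ) :
    ((archSideOfT' V c hGR hGR₀ hGR₁ hGR₂ hGR₃ η hη hηc ν hν hνc ν' hν' hν'c h₁W A).P k).IsThetaArchContinuous N :=
  ((archSideOfT' V c hGR hGR₀ hGR₁ hGR₂ hGR₃ η hη hηc ν hν hνc ν' hν' hν'c h₁W A).P k).isThetaArchContinuous_of_isLFContinuous
    (isLFAction_archSideOfT' V c hGR hGR₀ hGR₁ hGR₂ hGR₃ η hη hηc ν hν hνc ν' hν' hν'c h₁W A k) N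

end Term

/-! ## § 3 the predicate-guarded total term over `archSideOfT'` -/

section GuardedT

variable {L : CMField} {ι₁ : L →+* ℂ} (V : HermSpace3 L ι₁) (c : SeesawCtx L) (G : Prop)
  (hG : G → (∀ j, 0 < (ι₁ (dW c.D j)).re) ∨ ∀ j, (ι₁ (dW c.D j)).re < 0)
  (hGR : (cmSplittingDatum (L : Type) finProdFinEquiv (frameD V) (frameD_real V) (frameD_ne V) (dW c.D) (dW_real c.D)
    (dW_ne c.D)).CompatibleSplitting)
  (hGR₀ : (cmSplittingDatum (L : Type) (e₁) (frameD V) (frameD_real V) (frameD_ne V) (lineVec (L : Type) (dW c.D 0))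
    (fun _ => dW_real c.D 0) (fun _ => dW_ne c.D 0)).CompatibleSplitting)
  (hGR₁ : (cmSplittingDatum (L : Type) (e₁) (frameD V) (frameD_real V) (frameD_ne V) (lineVec (L : Type) (dW c.D 1))
    (fun _ => dW_real c.D 1) (fun _ => dW_ne c.D 1)).CompatibleSplitting)
  (hGR₂ : (cmSplittingDatum (L : Type) (e₁) (frameD V) (frameD_real V) (frameD_ne V) (lineVec (L : Type) (dW' c.D 0))
    (fun _ => dW'_real c.D 0) (fun _ => dW'_ne c.D 0)).CompatibleSplitting)
  (hGR₃ : (cmSplittingDatum (L : Type) (e₁) (frameD V) (frameD_real V) (frameD_ne V) (lineVec (L : Type) (dW' c.D 1))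
    (fun _ => dW'_real c.D 1) (fun _ => dW'_ne c.D 1)).CompatibleSplitting)
  (η : CMAdelic (L : Type) (frameD V) × CMAdelic (L : Type) (dW c.D) →* ℂˣ)
  (hη : ∀ γU ∈ CMRat (L : Type) (frameD V), ∀ γ ∈ CMRat (L : Type) (dW c.D), η (γU, γ) = 1)
  (hηc : Continuous fun p => ((η p : ℂˣ) : ℂ))
  (ν : CMAdelic (L : Type) (frameD V) →* ℂˣ)
  (hν : ∀ γU ∈ CMRat (L : Type) (frameD V), ν γU = 1)
  (hνc : Continuous fun v => ((ν v : ℂˣ) : ℂ))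
  (ν' : CMAdelic (L : Type) (frameD V) →* ℂˣ)
  (hν' : ∀ γU ∈ CMRat (L : Type) (frameD V), ν' γU = 1)
  (hν'c : Continuous fun v => ((ν' v : ℂˣ) : ℂ))
  (AG : G → ∀ k : Fin 4, ArchLineInput V (lineRepT' V c.D hGR hGR₀ hGR₁ hGR₂ hGR₃ η ν ν' k))

open scoped Classical in
/-- **the PREDICATE-GUARDED total doubly twisted S term**: `archSideOfT'` under the guard, sanity-1's degenerate side elsewhere. -/
def thetaAdelicSideOfPT' : ThetaAdelicSide V c :=
  if hc : G then archSideOfT' V c hGR hGR₀ hGR₁ hGR₂ hGR₃ η hη hηc ν hν hνc ν' hν' hν'c (hG hc) (AG hc) else Sanity.degThetaAdelicSide₀ V c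

/-- (Ported verbatim from the HodgeCMPerL package; no docstring in the source.) -/
theorem thetaAdelicSideOfPT'_eq_archSideOfT' (hc : G) :
    thetaAdelicSideOfPT' V c G hG hGR hGR₀ hGR₁ hGR₂ hGR₃ η hη hηc ν hν hνc ν' hν' hν'c AG =
      archSideOfT' V c hGR hGR₀ hGR₁ hGR₂ hGR₃ η hη hηc ν hν hνc ν' hν' hν'c (hG hc) (AG hc) := by
  classical
  exact dif_pos hc

/-- (Ported verbatim from the HodgeCMPerL package; no docstring in the source.) -/
theorem thetaAdelicSideOfPT'_eq_degThetaAdelicSide₀ (hc : ¬ G) :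
    thetaAdelicSideOfPT' V c G hG hGR hGR₀ hGR₁ hGR₂ hGR₃ η hη hηc ν hν hνc ν' hν' hν'c AG = Sanity.degThetaAdelicSide₀ V c := by
  classical
  exact dif_neg hc

/-- (Ported verbatim from the HodgeCMPerL package; no docstring in the source.) -/
theorem thetaAdelicSideOfPT'_P_ω (hc : G) (k : Fin 4) :
    ((thetaAdelicSideOfPT' V c G hG hGR hGR₀ hGR₁ hGR₂ hGR₃ η hη hηc ν hν hνc ν' hν' hν'c AG).P k).ω =
      lineRepT' V c.D hGR hGR₀ hGR₁ hGR₂ hGR₃ η ν ν' k := by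
  rw [thetaAdelicSideOfPT'_eq_archSideOfT' V c G hG hGR hGR₀ hGR₁ hGR₂ hGR₃ η hη hηc ν hν hνc ν' hν' hν'c AG hc]; rfl

/-- (Ported verbatim from the HodgeCMPerL package; no docstring in the source.) -/
theorem thetaAdelicSideOfPT'_P_Φinf (hc : G) (k : Fin 4) :
    ((thetaAdelicSideOfPT' V c G hG hGR hGR₀ hGR₁ hGR₂ hGR₃ η hη hηc ν hν hνc ν' hν' hν'c AG).P k).Φinf = (AG hc k).Φinf := by
  rw [thetaAdelicSideOfPT'_eq_archSideOfT' V c G hG hGR hGR₀ hGR₁ hGR₂ hGR₃ η hη hηc ν hν hνc ν' hν' hν'c AG hc]; rfl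

/-- (Ported verbatim from the HodgeCMPerL package; no docstring in the source.) -/
theorem thetaAdelicSideOfPT'_P_x₀ (hc : G) (k : Fin 4) :
    ((thetaAdelicSideOfPT' V c G hG hGR hGR₀ hGR₁ hGR₂ hGR₃ η hη hηc ν hν hνc ν' hν' hν'c AG).P k).x₀ = (AG hc k).x₀ := by
  rw [thetaAdelicSideOfPT'_eq_archSideOfT' V c G hG hGR hGR₀ hGR₁ hGR₂ hGR₃ η hη hηc ν hν hνc ν' hν' hν'c AG hc]; rfl

/-- (Ported verbatim from the HodgeCMPerL package; no docstring in the source.) -/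
theorem thetaAdelicSideOfPT'_P_w (hc : G) (k : Fin 4) :
    ((thetaAdelicSideOfPT' V c G hG hGR hGR₀ hGR₁ hGR₂ hGR₃ η hη hηc ν hν hνc ν' hν' hν'c AG).P k).w = (AG hc k).w := by
  rw [thetaAdelicSideOfPT'_eq_archSideOfT' V c G hG hGR hGR₀ hGR₁ hGR₂ hGR₃ η hη hηc ν hν hνc ν' hν' hν'c AG hc]; rfl

/-- (Ported verbatim from the HodgeCMPerL package; no docstring in the source.) -/
theorem thetaAdelicSideOfPT'_ιinf_apply (hc : G) (hV : IsAnisotropic L V.Hm) (u : U21) :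
    (thetaAdelicSideOfPT' V c G hG hGR hGR₀ hGR₁ hGR₂ hGR₃ η hη hηc ν hν hνc ν' hν' hν'c AG).ιinf u =
      Adelic.regimeEquiv L V.Hm hV
        (UnitaryGroup.archSectionU21CM (L : Type) ι₁ V.Hm V.sylvesterFrame (sylvesterFrame_J V) u) := by
  rw [thetaAdelicSideOfPT'_eq_archSideOfT' V c G hG hGR hGR₀ hGR₁ hGR₂ hGR₃ η hη hηc ν hν hνc ν' hν' hν'c AG hc]
  exact archSideOfT'_ιinf_apply V c hGR hGR₀ hGR₁ hGR₂ hGR₃ η hη hηc ν hν hνc ν' hν' hν'c _ (AG hc) hV u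

/-- `hLF` at the guarded doubly twisted term, both branches. -/
theorem isLFAction_thetaAdelicSideOfPT' (k : Fin 4) :
    ((thetaAdelicSideOfPT' V c G hG hGR hGR₀ hGR₁ hGR₂ hGR₃ η hη hηc ν hν hνc ν' hν' hν'c AG).P k).IsLFAction := by
  by_cases hc : G
  · rw [thetaAdelicSideOfPT'_eq_archSideOfT' V c G hG hGR hGR₀ hGR₁ hGR₂ hGR₃ η hη hηc ν hν hνc ν' hν' hν'c AG hc]
    exact isLFAction_archSideOfT' V c hGR hGR₀ hGR₁ hGR₂ hGR₃ η hη hηc ν hν hνc ν' hν' hν'c _ (AG hc) k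
  · rw [thetaAdelicSideOfPT'_eq_degThetaAdelicSide₀ V c G hG hGR hGR₀ hGR₁ hGR₂ hGR₃ η hη hηc ν hν hνc ν' hν' hν'c AG hc]
    exact Sanity.isLFAction_degThetaAdelicSide₀ V c k

/-- row 13 `hT` at the guarded doubly twisted term, both branches. -/
theorem isThetaArchContinuous_thetaAdelicSideOfPT' (k : Fin 4) (N : ℕ) :
    ((thetaAdelicSideOfPT' V c G hG hGR hGR₀ hGR₁ hGR₂ hGR₃ η hη hηc ν hν hνc ν' hν' hν'c AG).P k).IsThetaArchContinuous N :=
  ((thetaAdelicSideOfPT' V c G hG hGR hGR₀ hGR₁ hGR₂ hGR₃ η hη hηc ν hν hνc ν' hν' hν'c AG).P k).isThetaArchContinuous_of_isLFContinuous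
    (isLFAction_thetaAdelicSideOfPT' V c G hG hGR hGR₀ hGR₁ hGR₂ hGR₃ η hη hηc ν hν hνc ν' hν' hν'c AG k) N

end GuardedT

end ArchSideTerm

/-! ## § 4 family level: `SGPT'`, `ART'`, and the assembled (J-μ-pin) families `SRT'` / `SROGT'` (twins of #1215's `SRT`/`SROGT`) -/

namespace SInstance

open HodgeCM.Model.ArchSideTerm

section FamilyT

variable
  (G : ∀ {L : CMField} {ι₁ : L →+* ℂ} (_V : HermSpace3 L ι₁) (_c : SeesawCtx L), Prop)
  (hG : ∀ {L : CMField} {ι₁ : L →+* ℂ} (V : HermSpace3 L ι₁) (c : SeesawCtx L), G V c → (∀ j, 0 < (ι₁ (dW c.D j)).re) ∨ ∀ j, (ι₁ (dW c.D j)).re < 0)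
  (hGR : ∀ {L : CMField} {ι₁ : L →+* ℂ} (V : HermSpace3 L ι₁) (c : SeesawCtx L),
    (cmSplittingDatum (L : Type) finProdFinEquiv (frameD V) (frameD_real V) (frameD_ne V) (dW c.D) (dW_real c.D)
      (dW_ne c.D)).CompatibleSplitting)
  (η : ∀ {L : CMField} {ι₁ : L →+* ℂ} (V : HermSpace3 L ι₁) (c : SeesawCtx L), CMAdelic (L : Type) (frameD V) × CMAdelic (L : Type) (dW c.D) →* ℂˣ)
  (hη : ∀ {L : CMField} {ι₁ : L →+* ℂ} (V : HermSpace3 L ι₁) (c : SeesawCtx L), ∀ γU ∈ CMRat (L : Type) (frameD V), ∀ γ ∈ CMRat (L : Type) (dW c.D), η V c (γU, γ) = 1)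
  (hηc : ∀ {L : CMField} {ι₁ : L →+* ℂ} (V : HermSpace3 L ι₁) (c : SeesawCtx L), Continuous fun p => ((η V c p : ℂˣ) : ℂ))
  (ν : ∀ {L : CMField} {ι₁ : L →+* ℂ} (V : HermSpace3 L ι₁) (_c : SeesawCtx L), CMAdelic (L : Type) (frameD V) →* ℂˣ)
  (hν : ∀ {L : CMField} {ι₁ : L →+* ℂ} (V : HermSpace3 L ι₁) (c : SeesawCtx L), ∀ γU ∈ CMRat (L : Type) (frameD V), ν V c γU = 1)
  (hνc : ∀ {L : CMField} {ι₁ : L →+* ℂ} (V : HermSpace3 L ι₁) (c : SeesawCtx L), Continuous fun v => ((ν V c v : ℂˣ) : ℂ))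
  (ν' : ∀ {L : CMField} {ι₁ : L →+* ℂ} (V : HermSpace3 L ι₁) (_c : SeesawCtx L), CMAdelic (L : Type) (frameD V) →* ℂˣ)
  (hν' : ∀ {L : CMField} {ι₁ : L →+* ℂ} (V : HermSpace3 L ι₁) (c : SeesawCtx L), ∀ γU ∈ CMRat (L : Type) (frameD V), ν' V c γU = 1)
  (hν'c : ∀ {L : CMField} {ι₁ : L →+* ℂ} (V : HermSpace3 L ι₁) (c : SeesawCtx L), Continuous fun v => ((ν' V c v : ℂˣ) : ℂ))
  (hGR₀ : ∀ {L : CMField} {ι₁ : L →+* ℂ} (V : HermSpace3 L ι₁) (c : SeesawCtx L),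
    (cmSplittingDatum (L : Type) (e₁) (frameD V) (frameD_real V) (frameD_ne V) (lineVec (L : Type) (dW c.D 0))
      (fun _ => dW_real c.D 0) (fun _ => dW_ne c.D 0)).CompatibleSplitting)
  (hGR₁ : ∀ {L : CMField} {ι₁ : L →+* ℂ} (V : HermSpace3 L ι₁) (c : SeesawCtx L),
    (cmSplittingDatum (L : Type) (e₁) (frameD V) (frameD_real V) (frameD_ne V) (lineVec (L : Type) (dW c.D 1))
      (fun _ => dW_real c.D 1) (fun _ => dW_ne c.D 1)).CompatibleSplitting)
  (hGR₂ : ∀ {L : CMField} {ι₁ : L →+* ℂ} (V : HermSpace3 L ι₁) (c : SeesawCtx L),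
    (cmSplittingDatum (L : Type) (e₁) (frameD V) (frameD_real V) (frameD_ne V) (lineVec (L : Type) (dW' c.D 0))
      (fun _ => dW'_real c.D 0) (fun _ => dW'_ne c.D 0)).CompatibleSplitting)
  (hGR₃ : ∀ {L : CMField} {ι₁ : L →+* ℂ} (V : HermSpace3 L ι₁) (c : SeesawCtx L),
    (cmSplittingDatum (L : Type) (e₁) (frameD V) (frameD_real V) (frameD_ne V) (lineVec (L : Type) (dW' c.D 1))
      (fun _ => dW'_real c.D 1) (fun _ => dW'_ne c.D 1)).CompatibleSplitting)
  (AG : ∀ {L : CMField} {ι₁ : L →+* ℂ} (V : HermSpace3 L ι₁) (c : SeesawCtx L), G V c → ∀ k : Fin 4,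
    ArchLineInput V (lineRepT' V c.D (hGR V c) (hGR₀ V c) (hGR₁ V c) (hGR₂ V c) (hGR₃ V c) (η V c) (ν V c) (ν' V c) k))

/-- **the guard-agnostic guarded DOUBLY TWISTED S family** (twin of #1215 `SGPT` over `archSideOfT'`). -/
abbrev SGPT' : ∀ {L : CMField} {ι₁ : L →+* ℂ} (V : HermSpace3 L ι₁) (c : SeesawCtx L), ThetaAdelicSide V c :=
  fun V c => thetaAdelicSideOfPT' V c (G V c) (hG V c) (hGR V c) (hGR₀ V c) (hGR₁ V c) (hGR₂ V c) (hGR₃ V c) (η V c) (hη V c) (hηc V c)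
    (ν V c) (hν V c) (hνc V c) (ν' V c) (hν' V c) (hν'c V c) (AG V c)

/-- (Ported verbatim from the HodgeCMPerL package; no docstring in the source.) -/
theorem SGPT'_eq_archSideOfT' {L : CMField} {ι₁ : L →+* ℂ} (V : HermSpace3 L ι₁) (c : SeesawCtx L) (hc : G V c) :
    SGPT' @G @hG @hGR @η @hη @hηc @ν @hν @hνc @ν' @hν' @hν'c @hGR₀ @hGR₁ @hGR₂ @hGR₃ @AG V c =
      archSideOfT' V c (hGR V c) (hGR₀ V c) (hGR₁ V c) (hGR₂ V c) (hGR₃ V c) (η V c) (hη V c) (hηc V c) (ν V c) (hν V c) (hνc V c)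
        (ν' V c) (hν' V c) (hν'c V c) (hG V c hc) (AG V c hc) :=
  thetaAdelicSideOfPT'_eq_archSideOfT' V c (G V c) _ _ _ _ _ _ _ _ _ _ _ _ _ _ _ _ hc

/-- `hLF` at the guarded doubly twisted family, hypothesis-free. -/
theorem hLF_PT' : ∀ {L : CMField} {ι₁ : L →+* ℂ} (V : HermSpace3 L ι₁) (c : SeesawCtx L) (k : Fin 4),
    ((SGPT' @G @hG @hGR @η @hη @hηc @ν @hν @hνc @ν' @hν' @hν'c @hGR₀ @hGR₁ @hGR₂ @hGR₃ @AG V c).P k).IsLFAction :=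
  fun V c k => isLFAction_thetaAdelicSideOfPT' V c (G V c) _ _ _ _ _ _ _ _ _ _ _ _ _ _ _ _ k

/-- **row 13 `hT` at the guarded doubly twisted family, hypothesis-free.** -/
theorem hT_PT' : ∀ {L : CMField} {ι₁ : L →+* ℂ} (V : HermSpace3 L ι₁) (c : SeesawCtx L) (k : Fin 4) (N : ℕ),
    ((SGPT' @G @hG @hGR @η @hη @hηc @ν @hν @hνc @ν' @hν' @hν'c @hGR₀ @hGR₁ @hGR₂ @hGR₃ @AG V c).P k).IsThetaArchContinuous N :=
  fun V c k N => isThetaArchContinuous_thetaAdelicSideOfPT' V c (G V c) _ _ _ _ _ _ _ _ _ _ _ _ _ _ _ _ k N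

end FamilyT

section ReadOffT

variable
  (G : ∀ {L : CMField} {ι₁ : L →+* ℂ} (_V : HermSpace3 L ι₁) (_c : SeesawCtx L), Prop)
  (hG : ∀ {L : CMField} {ι₁ : L →+* ℂ} (V : HermSpace3 L ι₁) (c : SeesawCtx L), G V c → (∀ j, 0 < (ι₁ (dW c.D j)).re) ∨ ∀ j, (ι₁ (dW c.D j)).re < 0)
  (hGR : ∀ {L : CMField} {ι₁ : L →+* ℂ} (V : HermSpace3 L ι₁) (c : SeesawCtx L),
    (cmSplittingDatum (L : Type) finProdFinEquiv (frameD V) (frameD_real V) (frameD_ne V) (dW c.D) (dW_real c.D)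
      (dW_ne c.D)).CompatibleSplitting)
  (χV : ∀ {L : CMField} {ι₁ : L →+* ℂ} (_V : HermSpace3 L ι₁) (_c : SeesawCtx L),
    ContinuousMonoidHom (Literature.NumberTheory.Automorphic.relNormOneIdeles (↥(NumberField.maximalRealSubfield (L : Type))) (L : Type) ⧸
      Literature.NumberTheory.Automorphic.relNormOneRat (↥(NumberField.maximalRealSubfield (L : Type))) (L : Type)) Circle)
  (ν : ∀ {L : CMField} {ι₁ : L →+* ℂ} (V : HermSpace3 L ι₁) (_c : SeesawCtx L), CMAdelic (L : Type) (frameD V) →* ℂˣ)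
  (hν : ∀ {L : CMField} {ι₁ : L →+* ℂ} (V : HermSpace3 L ι₁) (c : SeesawCtx L), ∀ γU ∈ CMRat (L : Type) (frameD V), ν V c γU = 1)
  (hνc : ∀ {L : CMField} {ι₁ : L →+* ℂ} (V : HermSpace3 L ι₁) (c : SeesawCtx L), Continuous fun v => ((ν V c v : ℂˣ) : ℂ))
  (ν' : ∀ {L : CMField} {ι₁ : L →+* ℂ} (V : HermSpace3 L ι₁) (_c : SeesawCtx L), CMAdelic (L : Type) (frameD V) →* ℂˣ)
  (hν' : ∀ {L : CMField} {ι₁ : L →+* ℂ} (V : HermSpace3 L ι₁) (c : SeesawCtx L), ∀ γU ∈ CMRat (L : Type) (frameD V), ν' V c γU = 1)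
  (hν'c : ∀ {L : CMField} {ι₁ : L →+* ℂ} (V : HermSpace3 L ι₁) (c : SeesawCtx L), Continuous fun v => ((ν' V c v : ℂˣ) : ℂ))
  (hGR₀ : ∀ {L : CMField} {ι₁ : L →+* ℂ} (V : HermSpace3 L ι₁) (c : SeesawCtx L),
    (cmSplittingDatum (L : Type) (e₁) (frameD V) (frameD_real V) (frameD_ne V) (lineVec (L : Type) (dW c.D 0))
      (fun _ => dW_real c.D 0) (fun _ => dW_ne c.D 0)).CompatibleSplitting)
  (hGR₁ : ∀ {L : CMField} {ι₁ : L →+* ℂ} (V : HermSpace3 L ι₁) (c : SeesawCtx L),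
    (cmSplittingDatum (L : Type) (e₁) (frameD V) (frameD_real V) (frameD_ne V) (lineVec (L : Type) (dW c.D 1))
      (fun _ => dW_real c.D 1) (fun _ => dW_ne c.D 1)).CompatibleSplitting)
  (hGR₂ : ∀ {L : CMField} {ι₁ : L →+* ℂ} (V : HermSpace3 L ι₁) (c : SeesawCtx L),
    (cmSplittingDatum (L : Type) (e₁) (frameD V) (frameD_real V) (frameD_ne V) (lineVec (L : Type) (dW' c.D 0))
      (fun _ => dW'_real c.D 0) (fun _ => dW'_ne c.D 0)).CompatibleSplitting)
  (hGR₃ : ∀ {L : CMField} {ι₁ : L →+* ℂ} (V : HermSpace3 L ι₁) (c : SeesawCtx L),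
    (cmSplittingDatum (L : Type) (e₁) (frameD V) (frameD_real V) (frameD_ne V) (lineVec (L : Type) (dW' c.D 1))
      (fun _ => dW'_real c.D 1) (fun _ => dW'_ne c.D 1)).CompatibleSplitting)
  (μ : ∀ {L : CMField}, SeesawCtx L → Fin 4 → NumberField.InfinitePlace (L : Type) → ℤ)
  (hpos : ∀ {L : CMField} {ι₁ : L →+* ℂ} (V : HermSpace3 L ι₁) (c : SeesawCtx L), G V c →
    0 < HypCensus.cmXW (L : Type) (frameD V) (lineVec (L : Type) (dW c.D 0)) (fun _ => dW_real c.D 0) ι₁ (HypCensus.cmPlace (L : Type) ι₁) 0 ∧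
    0 < HypCensus.cmXW (L : Type) (frameD V) (lineVec (L : Type) (dW c.D 1)) (fun _ => dW_real c.D 1) ι₁ (HypCensus.cmPlace (L : Type) ι₁) 0 ∧
    0 < HypCensus.cmXW (L : Type) (frameD V) (lineVec (L : Type) (dW' c.D 0)) (fun _ => dW'_real c.D 0) ι₁ (HypCensus.cmPlace (L : Type) ι₁) 0 ∧
    0 < HypCensus.cmXW (L : Type) (frameD V) (lineVec (L : Type) (dW' c.D 1)) (fun _ => dW'_real c.D 1) ι₁ (HypCensus.cmPlace (L : Type) ι₁) 0)
  (hΔ₁ : ∀ {L : CMField} {ι₁ : L →+* ℂ} (V : HermSpace3 L ι₁) (c : SeesawCtx L), ∀ hc : G V c,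
    slotTypeVec V c (hGR V c) (hGR₀ V c) (hGR₁ V c) (hGR₂ V c) (hGR₃ V c) (hG V c hc) 1 -
      slotTypeVec V c (hGR V c) (hGR₀ V c) (hGR₁ V c) (hGR₂ V c) (hGR₃ V c) (hG V c hc) 0 = μ c 1 - μ c 0)
  (hΔ₂ : ∀ {L : CMField} {ι₁ : L →+* ℂ} (V : HermSpace3 L ι₁) (c : SeesawCtx L), ∀ hc : G V c,
    slotTypeVec V c (hGR V c) (hGR₀ V c) (hGR₁ V c) (hGR₂ V c) (hGR₃ V c) (hG V c hc) 2 -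
      slotTypeVec V c (hGR V c) (hGR₀ V c) (hGR₁ V c) (hGR₂ V c) (hGR₃ V c) (hG V c hc) 0 = μ c 2 - μ c 0)
  (hΔ₃ : ∀ {L : CMField} {ι₁ : L →+* ℂ} (V : HermSpace3 L ι₁) (c : SeesawCtx L), ∀ hc : G V c,
    slotTypeVec V c (hGR V c) (hGR₀ V c) (hGR₁ V c) (hGR₂ V c) (hGR₃ V c) (hG V c hc) 3 -
      slotTypeVec V c (hGR V c) (hGR₀ V c) (hGR₁ V c) (hGR₂ V c) (hGR₃ V c) (hG V c hc) 0 = μ c 3 - μ c 0)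

/-- the archimedean inputs of the (J-μ-pin) read-off datum (#1212 `AR`), TRANSPORTED to the doubly twisted lines (pin R2). -/
def ART' : ∀ {L : CMField} {ι₁ : L →+* ℂ} (V : HermSpace3 L ι₁) (c : SeesawCtx L), G V c → ∀ k : Fin 4,
    ArchLineInput V (lineRepT' V c.D (hGR V c) (hGR₀ V c) (hGR₁ V c) (hGR₂ V c) (hGR₃ V c)
      (EtaChi.η @χV (@χWR @hGR @hGR₀ @hGR₁ @μ) V c) (ν V c) (ν' V c) k) :=
  fun V c hc k => archLineInputT' V c.D (hGR V c) (hGR₀ V c) (hGR₁ V c) (hGR₂ V c) (hGR₃ V c) _ (ν V c) (ν' V c) k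
    (AR @G @hG @hGR @χV @hGR₀ @hGR₁ @hGR₂ @hGR₃ @μ @hpos @hΔ₁ @hΔ₂ @hΔ₃ V c hc k)


-- port_pkg: scope closed for this part
end ReadOffT
end SInstance
end HodgeCM.Model
end
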